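import Mathlib
import HarnessLib
import Literature.Analysis.FluidPDE.VorticityCalculus
import Literature.Analysis.FluidPDE.BiotSavartHolder
import Literature.Analysis.FluidPDE.BiotSavartHolderCurl
import Literature.Analysis.FluidPDE.BiotSavartBounds
import Literature.Analysis.FluidPDE.BiotSavartCurlPair
import Literature.Analysis.FluidPDE.HarmonicBallMeanValue
import Literature.Analysis.FluidPDE.SingularKernelGradient
import Literature.Analysis.FluidPDE.PoincareHomotopyOperatorL2
import Summits.NavierStokesRegularity.NavierStokesRegularity.Theorems.IsobarTomographyBlobRiccatiClosureHolderHalfTools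
import Summits.NavierStokesRegularity.NavierStokesRegularity.Theorems.IsobarTomographyBlobRiccatiClosureCutoffTools
import Summits.NavierStokesRegularity.NavierStokesRegularity.Theorems.IsobarTomographyBlobRiccatiClosureBiotSavartSmooth
import Summits.NavierStokesRegularity.NavierStokesRegularity.Theorems.IsobarTomographyBlobRiccatiClosureLocalHarmonic
import Summits.NavierStokesRegularity.NavierStokesRegularity.Theorems.IsobarTomographyBlobRiccatiClosureStubCurlSmul
import Summits.NavierStokesRegularity.NavierStokesRegularity.Theorems.IsobarTomographyBlobRiccatiClosureDivCurlTools

/-!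
# Crux `IsobarTomography.BlobRiccatiClosure` (stmt-NavierStokesRegularity-11740), line
# `type-i-apex-liouville` — div–curl tomography of the velocity gradient (stub `stub_divCurlGradientBound`)

Helper file (theorems only) `--supports` the item. The residual C of the line (`stub_apexAntiBlob`:
Type-I apexes are anti-blob) asks in its κ-free form that every apex of a Type-I ancient mild
field be vorticity-dominated (`|S|² ≤ ½‖ω‖²`). This file supplies the elliptic input of the
qualitative, class-uniform version of that statement (the apex scale floor, landed separately):
a LOCAL, QUANTITATIVE div–curl estimate of the velocity gradient of a bounded divergence-free
field in terms of its vorticity, with Hölder-½ interpolation making the vorticity enter through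
`sup|ω|` times only a square root of its Lipschitz constant:

  `‖∇W(x)‖ ≤ c₀ (B + A/R + √(R B B₁) + √(A A₁/R))`   (`stub_divCurlGradientBound`)

for `|W| ≤ A`, `‖∇W‖ ≤ A₁`, `|curl W| ≤ B`, `curl W` `B₁`-Lipschitz, any `R > 0`. On a Type-I
slice (`A = C/√(−t)`, `A₁ = K₁/(−t)`, `B = ε/(−t)`, `B₁ = 4K₂(−t)^{-3/2}`, `R = M√(−t)`) the right
side is `c₀(ε + C/M + 2√(MεK₂) + √(CK₁/M))/(−t)`: small scaled vorticity forces small gauge strain.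

## Proof

Localise with the cutoff `χ = χ_R` (`suppCutoff x R`: `= 1` on `B̄(x,R)`, supported in
`B̄(x,2R)`, `‖∇χ‖ ≤ c₁/R`, `∇χ` `(c₂/R²)`-Lipschitz — `stub_cutoffTools`). The localised vorticity
`f = curl (χW) = χ ω + ∇χ × W` (`stub_curlSmul`) is `C²`, compactly supported, divergence free,
bounded by `B + c₁A/R`, and Hölder-½ with constant
`√(2BB₁) + B√(2c₁/R) + (c₁/R)√(2AA₁) + A√(2c₁c₂/R³)` (`stub_holderHalfTools`). Its Biot–Savart
velocity `v = K₃ ∗ f` is `C²` (`stub_biotSavartSmooth`), has `‖∇v(x)‖ ≤ c(C_f √(2R) + ‖f‖_∞)`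
(Majda–Bertozzi (4.39): `exists_norm_fderiv_biotSavart_le`), `|v| ≤ 10R‖f‖_∞` (Lemma 4.5:
`norm_biotSavart_le_of_support_subset`), `div v = 0` and `curl v = f`
(`isDivFree_biotSavart_of_holderWith`, `curl_biotSavart_eq_of_holderWith`). The remainder
`h = W − v` is curl- and divergence-free on `B(x,R)`, hence harmonic there (`stub_localHarmonic`),
and the interior gradient estimate on balls (`abs_fderiv_apply_le_of_laplacian_eq_zero` with the
weight `λ^{R/4,R/2}`, rescaled: `stub_divCurlHarmonicBound`, file `…DivCurlTools`) gives
`‖∇h(x)‖ ≤ c₃ (A + 10R‖f‖_∞)/R`. Summing and `√(2R)√(2t) = 2√(Rt)` give the claim.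

## References

* A. J. Majda, A. L. Bertozzi, *Vorticity and Incompressible Flow* (CUP 2002), §4.1.3
  Lemmas 4.5–4.6, (4.39). [MajdaBertozziCUP2002]
* D. Gilbarg, N. S. Trudinger, *Elliptic PDE of Second Order* (2001), Thm 2.10. [GilbargTrudinger2001]
-/

noncomputable section

open Set Filter Topology Function MeasureTheory Metric
open scoped RealInnerProductSpace NNReal Laplacian

-- the summit and its single sub-problem share the name (CONVENTIONS §1), as in every Theorems file
set_option linter.dupNamespace false

namespace Summit.NavierStokesRegularity.NavierStokesRegularity.Theorems.BlobRiccatiClosure.TypeIApexLiouville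

open Literature.Analysis Literature.Analysis.FluidPDE

/-! ### The div–curl tomography of the velocity gradient -/

/-- **Div–curl tomography of the velocity gradient (registered stub `stub_divCurlGradientBound`).**
There is a universal `c₀ > 0` such that for every `C³` divergence-free field `W` on `ℝ³` with
`|W| ≤ A`, `‖∇W‖ ≤ A₁`, `|curl W| ≤ B`, `curl W` `B₁`-Lipschitz, every radius `R > 0` and every
point `x`,

  `‖∇W(x)‖ ≤ c₀ (B + A/R + √(R B B₁) + √(A A₁/R))`.

Proof. Localise with the cutoff `χ = χ_R` (`= 1` on `B̄(x,R)`, supported in `B̄(x,2R)`,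
`‖∇χ‖ ≤ c₁/R`, `∇χ` `(c₂/R²)`-Lipschitz): the vorticity `f = curl (χW) = χ ω + ∇χ × W` is
compactly supported, divergence free, bounded by `B + c₁A/R` and Hölder-½ with constant
`√(2BB₁) + B√(2c₁/R) + (c₁/R)√(2AA₁) + A√(2c₁c₂/R³)` (interpolation between sup and Lipschitz
bounds). Its Biot–Savart velocity `v = K₃ ∗ f` has `‖∇v(x)‖ ≤ c(C_f √(2R) + ‖f‖_∞)`
(Majda–Bertozzi (4.39), the tree's `exists_norm_fderiv_biotSavart_le`), `|v| ≤ 10 R ‖f‖_∞`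
(Lemma 4.5), `div v = 0`, `curl v = f`. The remainder `h = W − v` is curl- and divergence-free on
`B(x, R)`, hence harmonic there, and the interior gradient estimate gives
`‖∇h(x)‖ ≤ c₃ (A + 10R‖f‖_∞)/R`. Summing and using `√(2R)√(2t) = 2√(Rt)` yields the claim.
[cite: MajdaBertozziCUP2002, §4.1.3 Lemma 4.5–4.6, (4.39); GilbargTrudinger2001, Thm 2.10] -/
theorem stub_divCurlGradientBound : ∃ c₀ : ℝ, 0 < c₀ ∧ ∀ (W : EuclideanSpace ℝ (Fin 3) → EuclideanSpace ℝ (Fin 3)) (A A₁ B B₁ R : ℝ) (x : EuclideanSpace ℝ (Fin 3)), ContDiff ℝ 3 W → VectorCalculus.IsDivFree W → (∀ y, ‖W y‖ ≤ A) → (∀ y, ‖fderiv ℝ W y‖ ≤ A₁) → (∀ y, ‖curl W y‖ ≤ B) → (∀ y y', ‖curl W y - curl W y'‖ ≤ B₁ * ‖y - y'‖) → 0 ≤ A → 0 ≤ A₁ → 0 ≤ B → 0 ≤ B₁ → 0 < R → ‖fderiv ℝ W x‖ ≤ c₀ * (B + A / R + Real.sqrt (R * B * B₁) + Real.sqrt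 (A * A₁ / R)) := by
  obtain ⟨cBS, hcBS0, hcBS⟩ := exists_norm_fderiv_biotSavart_le (γ := (1 / 2 : ℝ≥0)) (by norm_num)
  obtain ⟨c₁, c₂, hc₁, hc₂, hcut⟩ := stub_cutoffTools
  obtain ⟨c₃, hc₃, hharm⟩ := stub_divCurlHarmonicBound
  obtain ⟨hHa, hHb, hHc, hHd, hHe⟩ := stub_holderHalfTools
  refine ⟨cBS * (2 + 2 * Real.sqrt c₁ + 2 * c₁ + 2 * Real.sqrt (c₁ * c₂) + 1 + c₁) +
      c₃ * (1 + 10 + 10 * c₁) + 1, by positivity,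
    fun W A A₁ B B₁ R x hW hdiv hA hA₁ hB hB₁lip hA0 hA₁0 hB0 hB₁0 hR => ?_⟩
  obtain ⟨-, hχlip, -, hgχ, hgχlip⟩ := hcut x R hR
  have hc₁R : 0 ≤ c₁ / R := by positivity
  have hc₂R : 0 ≤ c₂ / R ^ 2 := by positivity
  -- the localised field and its vorticity
  set χ : EuclideanSpace ℝ (Fin 3) → ℝ := suppCutoff x R with hχdef
  set g : EuclideanSpace ℝ (Fin 3) → EuclideanSpace ℝ (Fin 3) := fun z => χ z • W z with hgdef
  set f : EuclideanSpace ℝ (Fin 3) → EuclideanSpace ℝ (Fin 3) := curl g with hfdef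
  have hχ3 : ContDiff ℝ 3 χ := contDiff_suppCutoff x R (n := 3)
  have hg3 : ContDiff ℝ 3 g := hχ3.smul hW
  have hf2 : ContDiff ℝ 2 f := contDiff_curl (n := 2) hg3
  have hWd : Differentiable ℝ W := hW.differentiable (by norm_num)
  have hfeq : f = fun y => χ y • curl W y + cross (gradient χ y) (W y) :=
    divCurl_curl_localise_eq hWd
  -- support
  have hfts : tsupport f ⊆ closedBall x (2 * R) := divCurl_tsupport_curl_localise_subset hR
  have hfsupp : support f ⊆ closedBall x (2 * R) := (subset_tsupport f).trans hfts
  have hfcs : HasCompactSupport f :=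
    HasCompactSupport.of_support_subset_isCompact (isCompact_closedBall x (2 * R)) hfsupp
  -- sup bound
  set Mf : ℝ := B + c₁ / R * A with hMfdef
  have hχ1 : ∀ y, ‖χ y‖ ≤ 1 := fun y => by
    rw [Real.norm_eq_abs]; exact abs_suppCutoff_le_one x R y
  have hMf : ∀ y, ‖f y‖ ≤ Mf := by
    intro y
    rw [hfeq]
    calc ‖χ y • curl W y + cross (gradient χ y) (W y)‖
        ≤ ‖χ y • curl W y‖ + ‖cross (gradient χ y) (W y)‖ := norm_add_le _ _
      _ ≤ 1 * B + c₁ / R * A := by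
          refine add_le_add ?_ ?_
          · rw [norm_smul]
            exact mul_le_mul (hχ1 y) (hB y) (norm_nonneg _) zero_le_one
          · exact (norm_cross_le _ _).trans
              (mul_le_mul (hgχ y) (hA y) (norm_nonneg _) hc₁R)
      _ = Mf := by rw [hMfdef]; ring
  have hMf0 : 0 ≤ Mf := (norm_nonneg _).trans (hMf x)
  -- Lipschitz facts
  have hωlip : LipschitzWith ⟨B₁, hB₁0⟩ (curl W) :=
    LipschitzWith.of_dist_le_mul fun y y' => by
      rw [dist_eq_norm, dist_eq_norm]; exact hB₁lip y y'
  have hWlip : LipschitzWith ⟨A₁, hA₁0⟩ W :=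
    LipschitzWith.of_dist_le_mul fun y y' => by
      rw [dist_eq_norm, dist_eq_norm]
      change ‖W y - W y'‖ ≤ A₁ * ‖y - y'‖
      rw [← norm_neg, neg_sub, ← norm_neg (y - y'), neg_sub]
      exact Convex.norm_image_sub_le_of_norm_fderiv_le (fun z _ => hWd z) (fun z _ => hA₁ z)
        convex_univ (mem_univ y) (mem_univ y')
  have hχlip' : LipschitzWith ⟨c₁ / R, hc₁R⟩ χ :=
    LipschitzWith.of_dist_le_mul fun y y' => by
      rw [Real.dist_eq, dist_eq_norm]; exact hχlip y y'
  have hgχlip' : LipschitzWith ⟨c₂ / R ^ 2, hc₂R⟩ (gradient χ) :=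
    LipschitzWith.of_dist_le_mul fun y y' => by
      rw [dist_eq_norm, dist_eq_norm]; exact hgχlip y y'
  -- bounds in `ℝ≥0` form
  have hBnn : ∀ y, ‖curl W y‖ ≤ ((⟨B, hB0⟩ : ℝ≥0) : ℝ) := fun y => hB y
  have hAnn : ∀ y, ‖W y‖ ≤ ((⟨A, hA0⟩ : ℝ≥0) : ℝ) := fun y => hA y
  have hχnn : ∀ y, ‖χ y‖ ≤ ((1 : ℝ≥0) : ℝ) := fun y => by rw [NNReal.coe_one]; exact hχ1 y
  have hgχnn : ∀ y, ‖gradient χ y‖ ≤ ((⟨c₁ / R, hc₁R⟩ : ℝ≥0) : ℝ) := fun y => hgχ y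
  -- Hölder-½ constants
  have hHω := hHa (curl W) ⟨B, hB0⟩ ⟨B₁, hB₁0⟩ hBnn hωlip
  have hHχ := hHb χ 1 ⟨c₁ / R, hc₁R⟩ hχnn hχlip'
  have hH1 := hHc χ (curl W) _ _ ⟨B, hB0⟩ hχ1 hHχ hBnn hHω
  have hHgχ := hHa (gradient χ) ⟨c₁ / R, hc₁R⟩ ⟨c₂ / R ^ 2, hc₂R⟩ hgχnn hgχlip'
  have hHW := hHa W ⟨A, hA0⟩ ⟨A₁, hA₁0⟩ hAnn hWlip
  have hH2 := hHd (gradient χ) W _ _ ⟨c₁ / R, hc₁R⟩ ⟨A, hA0⟩ hgχnn hHgχ hAnn hHW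
  have hHf' := hHe _ _ _ _ hH1 hH2
  set Cf : ℝ≥0 := NNReal.sqrt (2 * ⟨B, hB0⟩ * ⟨B₁, hB₁0⟩) + ⟨B, hB0⟩ * NNReal.sqrt (2 * 1 * ⟨c₁ / R, hc₁R⟩) +
      (⟨c₁ / R, hc₁R⟩ * NNReal.sqrt (2 * ⟨A, hA0⟩ * ⟨A₁, hA₁0⟩) +
        ⟨A, hA0⟩ * NNReal.sqrt (2 * ⟨c₁ / R, hc₁R⟩ * ⟨c₂ / R ^ 2, hc₂R⟩)) with hCfdef
  have hHf : HolderWith Cf (1 / 2) f := by rw [hfeq]; exact hHf'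
  have hCf : (Cf : ℝ) = Real.sqrt (2 * B * B₁) + B * Real.sqrt (2 * 1 * (c₁ / R)) +
      (c₁ / R * Real.sqrt (2 * A * A₁) + A * Real.sqrt (2 * (c₁ / R) * (c₂ / R ^ 2))) := by
    rw [hCfdef]
    simp only [NNReal.coe_add, NNReal.coe_mul, Real.coe_sqrt, NNReal.coe_one, NNReal.coe_ofNat]
    rfl
  -- the Biot–Savart velocity of `f`
  set v : EuclideanSpace ℝ (Fin 3) → EuclideanSpace ℝ (Fin 3) := biotSavart f with hvdef
  have hv2 : ContDiff ℝ 2 v := stub_biotSavartSmooth 2 f hf2 hfcs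
  have h2R : 0 < 2 * R := by positivity
  have hfdv : ‖fderiv ℝ v x‖ ≤ cBS * (Cf * (2 * R) ^ ((1 / 2 : ℝ≥0) : ℝ) + Mf) :=
    hcBS f Cf x (2 * R) Mf h2R hHf hfts hMf x
  have hvbd : ∀ y, ‖v y‖ ≤ 5 * Mf * (2 * R) := fun y =>
    norm_biotSavart_le_of_support_subset h2R hMf hfsupp y
  have hhalf : (0 : ℝ≥0) < 1 / 2 := by norm_num
  have hvdiv : VectorCalculus.IsDivFree v := isDivFree_biotSavart_of_holderWith hhalf hHf hfcs
  have hvcurl : curl v = f :=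
    curl_biotSavart_eq_of_holderWith hhalf hHf hfcs (isWeaklyDivFree_curl (hg3.of_le (by norm_num)))
  have hvd : Differentiable ℝ v := hv2.differentiable (by norm_num)
  -- the harmonic remainder `h = W - v`
  set h : EuclideanSpace ℝ (Fin 3) → EuclideanSpace ℝ (Fin 3) := fun y => W y - v y with hhdef
  have hh2 : ContDiff ℝ 2 h := (hW.of_le (by norm_num)).sub hv2
  have hfdsub : ∀ w, fderiv ℝ h w = fderiv ℝ W w - fderiv ℝ v w := fun w =>
    fderiv_fun_sub (hWd w) (hvd w)
  have hcurlh : ∀ w ∈ ball x R, curl h w = 0 := by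
    intro w hw
    rw [curl_eq_curlCLM, hfdsub, map_sub, ← curl_eq_curlCLM, ← curl_eq_curlCLM, hvcurl, hfdef,
      divCurl_curl_localise_eq_of_mem_ball hR hw, sub_self]
  have hdivh : ∀ w ∈ ball x R, VectorCalculus.divergence h w = 0 := by
    intro w _
    rw [VectorCalculus.divergence, hfdsub, ContinuousLinearMap.toLinearMap_sub, map_sub]
    change VectorCalculus.divergence W w - VectorCalculus.divergence v w = 0
    rw [hdiv w, hvdiv w, sub_zero]
  have hΔh : ∀ w ∈ ball x R, (Δ h) w = 0 := stub_localHarmonic h x R hh2 hcurlh hdivh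
  have hSbd : ∀ w ∈ closedBall x R, ‖h w‖ ≤ A + 5 * Mf * (2 * R) := fun w _ =>
    (norm_sub_le _ _).trans (add_le_add (hA w) (hvbd w))
  have hfdh : ‖fderiv ℝ h x‖ ≤ c₃ * (A + 5 * Mf * (2 * R)) / R := hharm h x R _ hR hh2 hΔh hSbd
  -- `∇W = ∇v + ∇h`
  have hsplit : fderiv ℝ W x = fderiv ℝ v x + fderiv ℝ h x := by
    rw [hfdsub, add_sub_cancel]
  -- the rpow exponent
  have hrpow : (2 * R) ^ ((1 / 2 : ℝ≥0) : ℝ) = Real.sqrt (2 * R) := by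
    rw [Real.sqrt_eq_rpow]; norm_num
  -- collect
  have htot : ‖fderiv ℝ W x‖ ≤ cBS * (Real.sqrt (2 * R) * (Cf : ℝ) + Mf) + c₃ * (A + 5 * Mf * (2 * R)) / R := by
    calc ‖fderiv ℝ W x‖ ≤ ‖fderiv ℝ v x‖ + ‖fderiv ℝ h x‖ := by rw [hsplit]; exact norm_add_le _ _
      _ ≤ cBS * (Cf * (2 * R) ^ ((1 / 2 : ℝ≥0) : ℝ) + Mf) + c₃ * (A + 5 * Mf * (2 * R)) / R :=
          add_le_add hfdv hfdh
      _ = _ := by rw [hrpow, mul_comm (Cf : ℝ)]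
  -- rewrite in the four scale-homogeneous quantities
  have hX₂ : 0 ≤ A / R := by positivity
  have hX₃ : 0 ≤ Real.sqrt (R * B * B₁) := Real.sqrt_nonneg _
  have hX₄ : 0 ≤ Real.sqrt (A * A₁ / R) := Real.sqrt_nonneg _
  have hdivR : c₃ * (A + 5 * Mf * (2 * R)) / R = c₃ * (A / R + 10 * Mf) := by
    field_simp
    ring
  have hkey : cBS * (Real.sqrt (2 * R) * (Cf : ℝ) + Mf) + c₃ * (A + 5 * Mf * (2 * R)) / R =
      (cBS * (2 * Real.sqrt c₁ + 1) + 10 * c₃) * B +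
        (cBS * (2 * Real.sqrt (c₁ * c₂) + c₁) + c₃ * (1 + 10 * c₁)) * (A / R) +
        (2 * cBS) * Real.sqrt (R * B * B₁) + (2 * c₁ * cBS) * Real.sqrt (A * A₁ / R) := by
    rw [hdivR, hCf, divCurl_sqrt_algebra A A₁ B B₁ c₁ c₂ hR, hMfdef]
    ring
  obtain ⟨hk₁, hk₂, hk₃, hk₄⟩ := divCurl_const_bounds hcBS0 hc₁ hc₂ hc₃
  calc ‖fderiv ℝ W x‖ ≤ _ := htot
    _ = _ := hkey
    _ ≤ (cBS * (2 + 2 * Real.sqrt c₁ + 2 * c₁ + 2 * Real.sqrt (c₁ * c₂) + 1 + c₁) +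
          c₃ * (1 + 10 + 10 * c₁) + 1) * B +
        (cBS * (2 + 2 * Real.sqrt c₁ + 2 * c₁ + 2 * Real.sqrt (c₁ * c₂) + 1 + c₁) +
          c₃ * (1 + 10 + 10 * c₁) + 1) * (A / R) +
        (cBS * (2 + 2 * Real.sqrt c₁ + 2 * c₁ + 2 * Real.sqrt (c₁ * c₂) + 1 + c₁) +
          c₃ * (1 + 10 + 10 * c₁) + 1) * Real.sqrt (R * B * B₁) +
        (cBS * (2 + 2 * Real.sqrt c₁ + 2 * c₁ + 2 * Real.sqrt (c₁ * c₂) + 1 + c₁) +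
          c₃ * (1 + 10 + 10 * c₁) + 1) * Real.sqrt (A * A₁ / R) :=
        add_le_add (add_le_add (add_le_add (mul_le_mul_of_nonneg_right hk₁ hB0)
          (mul_le_mul_of_nonneg_right hk₂ hX₂)) (mul_le_mul_of_nonneg_right hk₃ hX₃))
          (mul_le_mul_of_nonneg_right hk₄ hX₄)
    _ = _ := by ring

end Summit.NavierStokesRegularity.NavierStokesRegularity.Theorems.BlobRiccatiClosure.TypeIApexLiouville

end
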